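import Summits.Ventures.CertifiedManyBodySolver.Certificates.HubRm2uTierP.Head
import Summits.Ventures.CertifiedManyBodySolver.Certificates.HubRm2uTierP.Hints017
import Summits.Ventures.CertifiedManyBodySolver.Rows.CorrWindowCertKernelChainQuotAdjFastBox

/-!
# tier-P instance (HubRm2u-R13-W3) — chain forest segment 64 of 96 (steps 214..216 from `[]`), file 1 of 1: steps 214..216 (topology (B): eval%-chained accumulators, import-serial INSIDE the segment only)

Generated by hubbard-algo-p2's untrusted exporter (emit_v0.py + emit_w3.py); every datum below is re-derived / re-checked by the kernel chain
(`stepEQA`, Rows/CorrWindowCertKernelChainQuotAdj.lean) or is inert. HONEST FRAMING (xx1): instance data / kernel replay of a CONTROL/CALIBRATION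
certificate (hub-Rm2-u′, 4^40-dyadic two-level Gram factors); nothing here is a theorem about the Hubbard model; no summit statement. [cite: Han2020Bootstrap, §3]
-/

set_option linter.style.longLine false
set_option maxRecDepth 100000
set_option maxHeartbeats 0

namespace Summit.Ventures.CertifiedManyBodySolver
namespace CARPolyWindow.TierP.HubRm2u
open Summit.Ventures.CertifiedQuantumChemistry Summit.Ventures.CertifiedQuantumChemistry.CARPoly
open Literature.MathematicalPhysics.QuantumLattice Literature.MathematicalPhysics.QuantumLattice.HubbardWave0
open Literature.Probability.LatticeModels
open CARPolyWindow CARPolyWindow.BoxGeom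

/-- segment 64 starts from the EMPTY accumulator before step 214 (chain forest, R-g4-11 (L6)). [folklore] -/
def C64_0 : SOSDual.EncPoly := []

/-- accumulator after step 215 within segment 64 (evaluated at elaboration; the kernel re-derives it in `step_214`). [folklore] -/
def C64_1 : SOSDual.EncPoly := eval% stepEQA D 2048 C64_0 (slices.getD 214 []) (hintsOfCodes Dr reps HC214)

/-- KERNEL FACT, step 214 of 350 (fast step (L7): `stepEQAFB_kernel`, box edition). [folklore] -/
theorem step_214 : C64_1 = stepEQA D 2048 C64_0 (slices.getD 214 []) (hintsOfCodes Dr reps HC214) :=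
  stepEQAFB_kernel 6 13 7 rfl (by decide +kernel)

/-- accumulator after step 216 within segment 64 (evaluated at elaboration; the kernel re-derives it in `step_215`). [folklore] -/
def C64_2 : SOSDual.EncPoly := eval% stepEQA D 2048 C64_1 (slices.getD 215 []) (hintsOfCodes Dr reps HC215)

/-- KERNEL FACT, step 215 of 350 (fast step (L7): `stepEQAFB_kernel`, box edition). [folklore] -/
theorem step_215 : C64_2 = stepEQA D 2048 C64_1 (slices.getD 215 []) (hintsOfCodes Dr reps HC215) :=
  stepEQAFB_kernel 6 13 7 rfl (by decide +kernel)

/-- accumulator after step 217 within segment 64 (evaluated at elaboration; the kernel re-derives it in `step_216`). [folklore] -/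
def C64_3 : SOSDual.EncPoly := eval% stepEQA D 2048 C64_2 (slices.getD 216 []) (hintsOfCodes Dr reps HC216)

/-- KERNEL FACT, step 216 of 350 (fast step (L7): `stepEQAFB_kernel`, box edition). [folklore] -/
theorem step_216 : C64_3 = stepEQA D 2048 C64_2 (slices.getD 216 []) (hintsOfCodes Dr reps HC216) :=
  stepEQAFB_kernel 6 13 7 rfl (by decide +kernel)


end CARPolyWindow.TierP.HubRm2u
end Summit.Ventures.CertifiedManyBodySolver
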